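import Mathlib
import Summits.QuantumFields.QCD.Theses.PauliWegnerSea
import Summits.QuantumFields.QCD.Theses.WilsonMobilityGap
import Summits.QuantumFields.QCD.Theses.GaussianLinkFrames
import Summits.QuantumFields.QCD.Theorems.PauliWegnerSeaPhaseQuenchedFlavourDecayReduction
import Summits.QuantumFields.QCD.Theorems.PauliWegnerSeaPhaseQuenchedFlavourDecayMinorMomentsCoreOfUniform
import Literature.MathematicalPhysics.QuantumFieldTheory.QCDAsymptoticScalingCouplingDivergence

/-!
# Crux `PhaseQuenchedFlavourDecay` (stmt-QuantumFields-9151): the CONSUMER-CHECKED RESTRICTION to honest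
# asymptotically free trajectories, and its reduction to the restricted a-priori core

Line `crossing-split-integrability`, lead c9 (2026-08-17), `--supports stmt-QuantumFields-9151`.

## What this file settles (kernel-checked bookkeeping; no new analysis)

The crux `PauliWegnerSea.PhaseQuenchedFlavourDecay` (= `WilsonMobilityGap.…` = `GaussianLinkFrames.…`, byte-identical)
reads `∀ N_f, ∀ reg : QCDRegularisation N_f, ∀ m > 0, UPPER → CONC`.  Because `QCDRegularisation` pins nothing about
`β_k ∈ ℝ`, `m_crit(k) ∈ ℝ`, `a_k / Z_m(k) > 0`, the crux is EQUIVALENT (landed p122904/p123056) to a universal statement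
over the whole `(β, bare-mass)` plane — negative and finite coupling, masses `≤ −1` included — of which its three consumers
use only the asymptotically free corner: each deciding theorem (`WilsonMobilityGap.closes`, `PauliWegnerSea.closes`,
`GaussianLinkFrames.closes`) applies the crux as `h N_f reg m hm hii` with, IN SCOPE, `N_f = 2 ∨ N_f = 3`,
`reg.HasMassScaling`, `reg.IsChiralAtZero`, `(reg.scheme 0 0 0).HasAsymptoticScaling`, clause (i) `∀ f, ∀ᶠ k, −1 < m_f(k)`,
clause (iii) LOWER and clause (iv) SIGN of `(Chiral)MobilityGap` / `ChiralOneScaleTrajectory`.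

* `PhaseQuenchedFlavourDecayAF` — the MAXIMAL FREE RESTRICTION C″ of the crux: all seven consumer-side hypotheses
  prepended, UPPER and CONC verbatim.  Any statement between the crux and C″ (drop any subset of the added hypotheses)
  is equally consumer-safe.
* `phaseQuenchedFlavourDecayAF_of_phaseQuenchedFlavourDecay` (and `_of_wmg`, `_of_glf`) — the typed crux implies C″
  (trivially), so nothing landed under 9151 is lost by the restriction.
* `wilsonMobilityGap_closes_of_AF`, `pauliWegnerSea_closes_of_AF`, `gaussianLinkFrames_closes_of_AF` — the three
  routes' deciding theorems RE-PROVED with C″ in place of the crux: C″ is a drop-in replacement in all three routes.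
* `MinorMomentsAF` — the correspondingly restricted a-priori core B⁺ (the open stub `stub_minorMomentsCore` ≡ Signature B
  of PROMOTE.md with the same seven hypotheses prepended): `(1+ε)`-moments of all `r × r` Wick minors, volume-uniform,
  eventually along honest AF trajectories only.
* `stub_restrictedReduction : MinorMomentsAF → PhaseQuenchedFlavourDecayAF` — C″ is CLOSED MODULO B⁺ by the landed
  composition `conc_of_upper_of_minorMoments'` (p105597), exactly as the crux is closed modulo B.
* `minorMomentsAF_of_aprioriMinorMoments`, `minorMomentsAF_of_uniformMinorMoments` — B ⇒ B⁺ and X ⇒ B⁺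
  (X = `UniformMinorMoments`, the reg-free uniform core, via the landed `stub_minorMomentsCore_of_uniform`, p122368).
* `eventually_le_beta_of_AF` — on C″'s trajectories `β_k → +∞` (`N_f ≤ 16`, landed
  `QCDRegularisation.tendsto_beta_atTop_of_hasAsymptoticScaling`): the constant-coupling regularisations that drive the
  diagonal argument of p123056 (crux ⟹ `(s, C)`-uniform constants over ALL `β ∈ ℝ`) are no longer admissible, so B⁺ does
  NOT contain the finite-β tilted Wegner–Minami estimate (⊋ the open crux stmt-QuantumFields-8966), nor the `β → −∞`
  discrete `Z₃`-flux DOS-regularity problem, nor the `m ≤ −1` region (crux NOTES c8 §4 (ii)–(iv)); what remains is the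
  weak-coupling scaling regime the routes are about.

Why (planner-facing): eight leads closed the typed crux modulo X and classified X as open-problem-sized BECAUSE of the
`∀β ∈ ℝ` universality; this file makes the remedy (R-restrict of crux NOTES c6 §3 / c7 §4 / VERDICT-c8) a copy-paste:
restate 9151 in all three route files as the body of `PhaseQuenchedFlavourDecayAF` (or any intermediate), keep every
`closes` proof with the extra arguments threaded as below, and promote B⁺ (body of `MinorMomentsAF`) as the single open
stub of the restated crux — `stub_restrictedReduction` is then the one-line closer.
-/

noncomputable section

namespace Summit.QuantumFields.QCD.Cruxes.PhaseQuenchedFlavourDecay.CrossingSplitIntegrability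

open scoped BigOperators
open MeasureTheory Filter
open Literature.MathematicalPhysics.QuantumFieldTheory Literature.MathematicalPhysics.QuantumLattice
  Literature.Probability.LatticeModels

/-- **C″ — the crux restricted to honest asymptotically free trajectories** (maximal free restriction): for
`N_f ∈ {2, 3}`, every `reg : QCDRegularisation N_f` and every `m > 0` such that `reg` has leading-log mass scaling, is
chiral at zero and scales asymptotically (hence `β_k → +∞`), the bare masses satisfy clause (i) `−1 < m_f(k)` eventually,
and clauses (iii) LOWER and (iv) SIGN of `MobilityGap` hold: UPPER (clause (ii), phase-quenched fractional-moment decay of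
the quark propagator at rate `δ a_k`) implies CONC (one rate `δ' a_k` of exponential decay of every flavour-charged
phase-quenched correlator `E₊⟨A(0)B(n e₀)⟩_F`).  UPPER and CONC are the crux's two displayed formulas, verbatim; the seven
prepended hypotheses are exactly what the three consuming `closes` theorems hold when they apply the crux. -/
def PhaseQuenchedFlavourDecayAF : Prop :=
  ∀ Nf : ℕ, Nf = 2 ∨ Nf = 3 → ∀ (reg : QCDRegularisation Nf) (m : Fin Nf → ℝ), (∀ f, 0 < m f) → reg.HasMassScaling → reg.IsChiralAtZero → (reg.scheme 0 0 0).HasAsymptoticScaling → (∀ f : Fin Nf, ∀ᶠ k in atTop, -1 < reg.mcrit k + reg.a k * m f / reg.Zm k) → (∃ s c₀ C₁ p : ℝ, 0 < s ∧ s < 1 ∧ 0 < c₀ ∧ ∀ᶠ k in atTop, ∀ S : ℕ, reg.L k ≤ S → ∀ (f : Fin Nf) (n : ℕ), n ≤ S → c₀ * Real.exp (-(C₁ * (reg.a k * n) + p * Real.log (n + 1))) ≤ (∫ U : GaugeConfig 4 (2 * S + 1) (Matrix.specialUnitaryGroup (Fin 3) ℂ), ‖(diracMatrix U fun fl => reg.mcrit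 k + reg.a k * m fl / reg.Zm k).det‖ * (∑ a : Fin 3, ∑ i : Fin 4, ∑ b : Fin 3, ∑ j : Fin 4, ‖(diracMatrix U fun fl => reg.mcrit k + reg.a k * m fl / reg.Zm k)⁻¹ (quarkEquiv (f, (Torus.proj (2 * S + 1) 0, a, i))) (quarkEquiv (f, (Torus.proj (2 * S + 1) (Pi.single 0 (n : ℤ)), b, j)))‖) ^ s ∂(wilsonMeasure (fundamentalRep (Fin 3)) (reg.β k))) / (∫ U : GaugeConfig 4 (2 * S + 1) (Matrix.specialUnitaryGroup (Fin 3) ℂ), ‖(diracMatrix U fun fl => reg.mcrit k + reg.a k * m fl / reg.Zm k).det‖ ∂(wilsonMeasure (fundamentalRep (Fin 3)) (reg.β k)))) → (∀ᶠ k in atTop, (1 / 2 : ℝ) ≤ ‖∫ U : GaugeConfig 4 (2 * reg.L k + 1) (Matrix.specialUnitaryGroup (Fin 3) ℂ), (diracMatrix U fun fl => reg.mcrit k + reg.a k * m fl / reg.Zm k).det ∂(wilsonMeasure (fundamentalRep (Fin 3)) (reg.β k))‖ / (∫ U : GaugeConfig 4 (2 * reg.L k + 1) (Matrix.specialUnitaryGroup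 (Fin 3) ℂ), ‖(diracMatrix U fun fl => reg.mcrit k + reg.a k * m fl / reg.Zm k).det‖ ∂(wilsonMeasure (fundamentalRep (Fin 3)) (reg.β k)))) → (∃ s δ C : ℝ, 0 < s ∧ s < 1 ∧ 0 < δ ∧ ∀ᶠ k in atTop, ∀ S : ℕ, reg.L k ≤ S → ∀ (f : Fin Nf) (v : Literature.Probability.LatticeModels.Site 4), v ∈ box 4 S → (∫ U : GaugeConfig 4 (2 * S + 1) (Matrix.specialUnitaryGroup (Fin 3) ℂ), ‖(diracMatrix U fun fl => reg.mcrit k + reg.a k * m fl / reg.Zm k).det‖ * (∑ a : Fin 3, ∑ i : Fin 4, ∑ b : Fin 3, ∑ j : Fin 4, ‖(diracMatrix U fun fl => reg.mcrit k + reg.a k * m fl / reg.Zm k)⁻¹ (quarkEquiv (f, (Torus.proj (2 * S + 1) 0, a, i))) (quarkEquiv (f, (Torus.proj (2 * S + 1) (v), b, j)))‖) ^ s ∂(wilsonMeasure (fundamentalRep (Fin 3)) (reg.β k))) / (∫ U : GaugeConfig 4 (2 * S + 1) (Matrix.specialUnitaryGroup (Fin 3) ℂ), ‖(diracMatrix U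 fun fl => reg.mcrit k + reg.a k * m fl / reg.Zm k).det‖ ∂(wilsonMeasure (fundamentalRep (Fin 3)) (reg.β k))) ≤ C * Real.exp (-(δ * (reg.a k * ‖v‖)))) → (∃ δ' : ℝ, 0 < δ' ∧ ∀ (R R' : ℕ) (A : QCDLatticeObservable Nf R) (B : QCDLatticeObservable Nf R'), (∃ (f₀ : Fin Nf) (q : ℤ), q ≠ 0 ∧ ∀ (θ : ℝ) (U : LGConfig 4 (Matrix.specialUnitaryGroup (Fin 3) ℂ)), ExteriorAlgebra.map (LinearMap.pi fun w => (Sum.elim (fun i => if (boxQuarkEquiv.symm i).1 = f₀ then Complex.exp (-((θ : ℂ) * Complex.I)) else 1) (fun i => if (boxQuarkEquiv.symm i).1 = f₀ then Complex.exp ((θ : ℂ) * Complex.I) else 1) (ofLex w)) • LinearMap.proj w) (A.F U) = Complex.exp (((q : ℝ) * θ : ℝ) * Complex.I) • A.F U) → ∃ C' : ℝ, ∀ᶠ k in atTop, ∀ S : ℕ, reg.L k ≤ S → ∀ n : ℕ, n ≤ S → ‖(∫ U : GaugeConfig 4 (2 * S + 1) (Matrix.specialUnitaryGroup (Fin 3)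 ℂ), (‖(diracMatrix U fun fl => reg.mcrit k + reg.a k * m fl / reg.Zm k).det‖ : ℂ) * (fermiIntegral (A.onTorus (2 * S + 1) 0 U * B.onTorus (2 * S + 1) (Pi.single 0 (n : ℤ)) U * fermiBoltzmann U fun fl => reg.mcrit k + reg.a k * m fl / reg.Zm k) / fermiIntegral (fermiBoltzmann U fun fl => reg.mcrit k + reg.a k * m fl / reg.Zm k)) ∂(wilsonMeasure (fundamentalRep (Fin 3)) (reg.β k))) / (∫ U : GaugeConfig 4 (2 * S + 1) (Matrix.specialUnitaryGroup (Fin 3) ℂ), (‖(diracMatrix U fun fl => reg.mcrit k + reg.a k * m fl / reg.Zm k).det‖ : ℂ) ∂(wilsonMeasure (fundamentalRep (Fin 3)) (reg.β k)))‖ ≤ C' * Real.exp (-(δ' * (reg.a k * n))))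

/-- **B⁺ — the restricted a-priori core**: along the same trajectories, UPPER implies `MinorMoments` — ONE `ε > 0` and, for
every minor size `r`, an eventual (in `k`) volume-uniform bound on the phase-quenched `(1+ε)`-moments of ALL `r × r` Wick
minors `det[(D⁻¹)(I a, J b)]` of the full quark propagator, with their integrability (the registered open stub
`stub_minorMomentsCore`, Signature B of PROMOTE.md, with C″'s seven hypotheses prepended). -/
def MinorMomentsAF : Prop :=
  ∀ Nf : ℕ, Nf = 2 ∨ Nf = 3 → ∀ (reg : QCDRegularisation Nf) (m : Fin Nf → ℝ), (∀ f, 0 < m f) → reg.HasMassScaling → reg.IsChiralAtZero → (reg.scheme 0 0 0).HasAsymptoticScaling → (∀ f : Fin Nf, ∀ᶠ k in atTop, -1 < reg.mcrit k + reg.a k * m f / reg.Zm k) → (∃ s c₀ C₁ p : ℝ, 0 < s ∧ s < 1 ∧ 0 < c₀ ∧ ∀ᶠ k in atTop, ∀ S : ℕ, reg.L k ≤ S → ∀ (f : Fin Nf) (n : ℕ), n ≤ S → c₀ * Real.exp (-(C₁ * (reg.a k * n) + p * Real.log (n + 1))) ≤ (∫ U : GaugeConfig 4 (2 * S + 1)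 (Matrix.specialUnitaryGroup (Fin 3) ℂ), ‖(diracMatrix U fun fl => reg.mcrit k + reg.a k * m fl / reg.Zm k).det‖ * (∑ a : Fin 3, ∑ i : Fin 4, ∑ b : Fin 3, ∑ j : Fin 4, ‖(diracMatrix U fun fl => reg.mcrit k + reg.a k * m fl / reg.Zm k)⁻¹ (quarkEquiv (f, (Torus.proj (2 * S + 1) 0, a, i))) (quarkEquiv (f, (Torus.proj (2 * S + 1) (Pi.single 0 (n : ℤ)), b, j)))‖) ^ s ∂(wilsonMeasure (fundamentalRep (Fin 3)) (reg.β k))) / (∫ U : GaugeConfig 4 (2 * S + 1) (Matrix.specialUnitaryGroup (Fin 3) ℂ), ‖(diracMatrix U fun fl => reg.mcrit k + reg.a k * m fl / reg.Zm k).det‖ ∂(wilsonMeasure (fundamentalRep (Fin 3)) (reg.β k)))) → (∀ᶠ k in atTop, (1 / 2 : ℝ) ≤ ‖∫ U : GaugeConfig 4 (2 * reg.L k + 1) (Matrix.specialUnitaryGroup (Fin 3) ℂ), (diracMatrix U fun fl => reg.mcrit k + reg.a k * m fl / reg.Zm k).det ∂(wilsonMeasure (fundamentalRep (Fin 3)) (reg.β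 k))‖ / (∫ U : GaugeConfig 4 (2 * reg.L k + 1) (Matrix.specialUnitaryGroup (Fin 3) ℂ), ‖(diracMatrix U fun fl => reg.mcrit k + reg.a k * m fl / reg.Zm k).det‖ ∂(wilsonMeasure (fundamentalRep (Fin 3)) (reg.β k)))) → (∃ s δ C : ℝ, 0 < s ∧ s < 1 ∧ 0 < δ ∧ ∀ᶠ k in atTop, ∀ S : ℕ, reg.L k ≤ S → ∀ (f : Fin Nf) (v : Literature.Probability.LatticeModels.Site 4), v ∈ box 4 S → (∫ U : GaugeConfig 4 (2 * S + 1) (Matrix.specialUnitaryGroup (Fin 3) ℂ), ‖(diracMatrix U fun fl => reg.mcrit k + reg.a k * m fl / reg.Zm k).det‖ * (∑ a : Fin 3, ∑ i : Fin 4, ∑ b : Fin 3, ∑ j : Fin 4, ‖(diracMatrix U fun fl => reg.mcrit k + reg.a k * m fl / reg.Zm k)⁻¹ (quarkEquiv (f, (Torus.proj (2 * S + 1) 0, a, i))) (quarkEquiv (f, (Torus.proj (2 * S + 1) (v), b, j)))‖) ^ s ∂(wilsonMeasure (fundamentalRep (Fin 3)) (reg.β k))) / (∫ U : GaugeConfig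 4 (2 * S + 1) (Matrix.specialUnitaryGroup (Fin 3) ℂ), ‖(diracMatrix U fun fl => reg.mcrit k + reg.a k * m fl / reg.Zm k).det‖ ∂(wilsonMeasure (fundamentalRep (Fin 3)) (reg.β k))) ≤ C * Real.exp (-(δ * (reg.a k * ‖v‖)))) → ∃ ε : ℝ, 0 < ε ∧ ∀ r : ℕ, ∃ C : ℝ, ∀ᶠ k in atTop, ∀ S : ℕ, reg.L k ≤ S → ∀ I J : Fin r → QuarkVar Nf (2 * S + 1), Integrable (fun U : GaugeConfig 4 (2 * S + 1) SU3 => ‖(Matrix.of fun a b : Fin r => (diracMatrix U fun fl => reg.mcrit k + reg.a k * m fl / reg.Zm k)⁻¹ (quarkEquiv (I a)) (quarkEquiv (J b))).det‖ ^ (1 + ε)) (qcdLatticeMeasure (2 * S + 1) (reg.β k) fun fl => reg.mcrit k + reg.a k * m fl / reg.Zm k) ∧ qcdPhaseQuenchedExpect (reg.β k) (2 * S + 1) (fun fl => reg.mcrit k + reg.a k * m fl / reg.Zm k) (fun U : GaugeConfig 4 (2 * S + 1) SU3 => ‖(Matrix.of fun a b : Fin r => (diracMatrix U fun fl => reg.mcrit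 k + reg.a k * m fl / reg.Zm k)⁻¹ (quarkEquiv (I a)) (quarkEquiv (J b))).det‖ ^ (1 + ε)) ≤ C

/-- The typed crux (route PauliWegnerSea's copy) implies its restriction C″ — trivially, by discarding hypotheses. -/
theorem phaseQuenchedFlavourDecayAF_of_phaseQuenchedFlavourDecay
    (h : Summit.QuantumFields.QCD.Theses.PauliWegnerSea.PhaseQuenchedFlavourDecay) : PhaseQuenchedFlavourDecayAF :=
  fun Nf _ reg m hm _ _ _ _ _ _ hU => h Nf reg m hm hU

/-- The typed crux (route WilsonMobilityGap's copy) implies C″. -/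
theorem phaseQuenchedFlavourDecayAF_of_wmg
    (h : Summit.QuantumFields.QCD.Theses.WilsonMobilityGap.PhaseQuenchedFlavourDecay) : PhaseQuenchedFlavourDecayAF :=
  fun Nf _ reg m hm _ _ _ _ _ _ hU => h Nf reg m hm hU

/-- The typed crux (route GaussianLinkFrames' copy) implies C″. -/
theorem phaseQuenchedFlavourDecayAF_of_glf
    (h : Summit.QuantumFields.QCD.Theses.GaussianLinkFrames.PhaseQuenchedFlavourDecay) : PhaseQuenchedFlavourDecayAF :=
  fun Nf _ reg m hm _ _ _ _ _ _ hU => h Nf reg m hm hU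

/-- The open core B (= registered `stub_minorMomentsCore`, hypothesis verbatim) implies the restricted core B⁺. -/
theorem minorMomentsAF_of_aprioriMinorMoments
    (hB : ∀ (Nf : ℕ) (reg : QCDRegularisation Nf) (m : Fin Nf → ℝ), (∀ f, 0 < m f) → (∃ s δ C : ℝ, 0 < s ∧ s < 1 ∧ 0 < δ ∧ ∀ᶠ k in atTop, ∀ S : ℕ, reg.L k ≤ S → ∀ (f : Fin Nf) (v : Literature.Probability.LatticeModels.Site 4), v ∈ box 4 S → (∫ U : GaugeConfig 4 (2 * S + 1) (Matrix.specialUnitaryGroup (Fin 3) ℂ), ‖(diracMatrix U fun fl => reg.mcrit k + reg.a k * m fl / reg.Zm k).det‖ * (∑ a : Fin 3, ∑ i : Fin 4, ∑ b : Fin 3, ∑ j : Fin 4, ‖(diracMatrix U fun fl => reg.mcrit k + reg.a k * m fl / reg.Zm k)⁻¹ (quarkEquiv (f, (Torus.proj (2 * S + 1) 0, a, i))) (quarkEquiv (f, (Torus.proj (2 * S + 1) (v), b, j)))‖) ^ s ∂(wilsonMeasure (fundamentalRep (Fin 3)) (reg.β k))) / (∫ U : GaugeConfig 4 (2 * S +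 1) (Matrix.specialUnitaryGroup (Fin 3) ℂ), ‖(diracMatrix U fun fl => reg.mcrit k + reg.a k * m fl / reg.Zm k).det‖ ∂(wilsonMeasure (fundamentalRep (Fin 3)) (reg.β k))) ≤ C * Real.exp (-(δ * (reg.a k * ‖v‖)))) → ∃ ε : ℝ, 0 < ε ∧ ∀ r : ℕ, ∃ C : ℝ, ∀ᶠ k in atTop, ∀ S : ℕ, reg.L k ≤ S → ∀ I J : Fin r → QuarkVar Nf (2 * S + 1), Integrable (fun U : GaugeConfig 4 (2 * S + 1) SU3 => ‖(Matrix.of fun a b : Fin r => (diracMatrix U fun fl => reg.mcrit k + reg.a k * m fl / reg.Zm k)⁻¹ (quarkEquiv (I a)) (quarkEquiv (J b))).det‖ ^ (1 + ε)) (qcdLatticeMeasure (2 * S + 1) (reg.β k) fun fl => reg.mcrit k + reg.a k * m fl / reg.Zm k) ∧ qcdPhaseQuenchedExpect (reg.β k) (2 * S + 1) (fun fl => reg.mcrit k + reg.a k * m fl / reg.Zm k) (fun U : GaugeConfig 4 (2 * S + 1) SU3 => ‖(Matrix.of fun a b : Fin r => (diracMatrix U fun fl => reg.mcrit k + reg.a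 k * m fl / reg.Zm k)⁻¹ (quarkEquiv (I a)) (quarkEquiv (J b))).det‖ ^ (1 + ε)) ≤ C) :
    MinorMomentsAF :=
  fun Nf _ reg m hm _ _ _ _ _ _ hU => hB Nf reg m hm hU

/-- The reg-free uniform core X = `UniformMinorMoments` (hypothesis verbatim) implies the restricted core B⁺
(via the landed `stub_minorMomentsCore_of_uniform`, p122368). -/
theorem minorMomentsAF_of_uniformMinorMoments
    (hX : ∀ (Nf : ℕ) (s C : ℝ), 0 < s → s < 1 → ∃ ε : ℝ, 0 < ε ∧ ∀ r : ℕ, ∃ Cr μ₀ Λ₀ : ℝ, 0 < μ₀ ∧ ∀ (β : ℝ) (mq : Fin Nf → ℝ) (μ : ℝ) (L : ℕ), 0 < μ → μ ≤ μ₀ → Λ₀ ≤ μ * L → (∀ S : ℕ, L ≤ S → ∀ (f : Fin Nf) (v : Literature.Probability.LatticeModels.Site 4), v ∈ box 4 S → (∫ U : GaugeConfig 4 (2 * S + 1) (Matrix.specialUnitaryGroup (Fin 3) ℂ), ‖(diracMatrix U mq).det‖ * (∑ a : Fin 3, ∑ i : Fin 4, ∑ b : Fin 3, ∑ j : Fin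 4, ‖(diracMatrix U mq)⁻¹ (quarkEquiv (f, (Torus.proj (2 * S + 1) 0, a, i))) (quarkEquiv (f, (Torus.proj (2 * S + 1) (v), b, j)))‖) ^ s ∂(wilsonMeasure (fundamentalRep (Fin 3)) β)) / (∫ U : GaugeConfig 4 (2 * S + 1) (Matrix.specialUnitaryGroup (Fin 3) ℂ), ‖(diracMatrix U mq).det‖ ∂(wilsonMeasure (fundamentalRep (Fin 3)) β)) ≤ C * Real.exp (-(μ * ‖v‖))) → ∀ S : ℕ, L ≤ S → ∀ I J : Fin r → QuarkVar Nf (2 * S + 1), Integrable (fun U : GaugeConfig 4 (2 * S + 1) SU3 => ‖(Matrix.of fun a b : Fin r => (diracMatrix U mq)⁻¹ (quarkEquiv (I a)) (quarkEquiv (J b))).det‖ ^ (1 + ε)) (qcdLatticeMeasure (2 * S + 1) β mq) ∧ qcdPhaseQuenchedExpect β (2 * S + 1) mq (fun U : GaugeConfig 4 (2 * S + 1) SU3 => ‖(Matrix.of fun a b : Fin r => (diracMatrix U mq)⁻¹ (quarkEquiv (I a)) (quarkEquiv (J b))).det‖ ^ (1 + ε)) ≤ Cr) :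
    MinorMomentsAF :=
  minorMomentsAF_of_aprioriMinorMoments (stub_minorMomentsCore_of_uniform hX)

/-- **stub r30 `stub_restrictedReduction` — C″ is closed modulo B⁺**: the restricted core implies the restricted crux, by
the landed composition of the line (`conc_of_upper_of_minorMoments'`: Wick in determinant form, crossing split below the
integrability edge, generalised Laplace expansion by crossing matchings, torus translation, phase-quenched summation). -/
theorem stub_restrictedReduction : MinorMomentsAF → PhaseQuenchedFlavourDecayAF :=
  fun hB Nf hNf reg m hm hMS hCh hAS hi hiii hiv hU =>
    conc_of_upper_of_minorMoments' Nf reg m hU (hB Nf hNf reg m hm hMS hCh hAS hi hiii hiv hU)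

/-- On C″'s trajectories the coupling is eventually WEAK: `N_f = 2 ∨ N_f = 3` and asymptotic scaling of `reg.scheme 0 0 0`
give `∀ β₀, ∀ᶠ k, β₀ ≤ β_k` (landed `QCDRegularisation.tendsto_beta_atTop_of_hasAsymptoticScaling`).  Consequently no
constant-coupling regularisation is admissible for C″, and the diagonal argument forcing `β`-uniform constants (p123056)
does not apply to it. -/
theorem eventually_le_beta_of_AF {Nf : ℕ} (hNf : Nf = 2 ∨ Nf = 3) (reg : QCDRegularisation Nf)
    (hAS : (reg.scheme 0 0 0).HasAsymptoticScaling) (β₀ : ℝ) : ∀ᶠ k in atTop, β₀ ≤ reg.β k := by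
  have hNf' : Nf ≤ 16 := by rcases hNf with rfl | rfl <;> norm_num
  exact (QCDRegularisation.tendsto_beta_atTop_of_hasAsymptoticScaling hNf' reg 0 0 0 hAS).eventually_ge_atTop β₀

/-- **Drop-in check, route WilsonMobilityGap**: its deciding theorem with C″ in place of the crux. -/
theorem wilsonMobilityGap_closes_of_AF
    (h1 : Summit.QuantumFields.QCD.Theses.WilsonMobilityGap.ChiralMobilityGap) (h2 : PhaseQuenchedFlavourDecayAF)
    (h3 : Summit.QuantumFields.QCD.Theses.WilsonMobilityGap.ChiralGluonicCompletion) : _root_.QCD := by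
  have key : ∀ Nf : ℕ, Nf = 2 ∨ Nf = 3 → QCDOf Nf := by
    intro Nf hNf
    obtain ⟨reg, hMS, hCh, hAS, h⟩ := h1 Nf hNf
    refine h3 Nf hNf ⟨reg, hMS, hCh, hAS, fun m hm => ?_⟩
    obtain ⟨hi, hii, hiii, hiv⟩ := h m hm
    exact ⟨⟨hi, hii, hiii, hiv⟩, h2 Nf hNf reg m hm hMS hCh hAS hi hiii hiv hii⟩
  exact ⟨key 2 (Or.inl rfl), key 3 (Or.inr rfl)⟩

/-- **Drop-in check, route PauliWegnerSea**: its deciding theorem with C″ in place of the crux. -/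
theorem pauliWegnerSea_closes_of_AF
    (h₁ : Summit.QuantumFields.QCD.Theses.PauliWegnerSea.FibreCofactorDomination)
    (h₂ : Summit.QuantumFields.QCD.Theses.PauliWegnerSea.FMClosureUnquenched)
    (h₃ : Summit.QuantumFields.QCD.Theses.PauliWegnerSea.TiltedFlatness)
    (h₄ : Summit.QuantumFields.QCD.Theses.PauliWegnerSea.ChiralOneScaleTrajectory)
    (h₅ : PhaseQuenchedFlavourDecayAF)
    (h₆ : Summit.QuantumFields.QCD.Theses.PauliWegnerSea.ChiralGluonicCompletion) : _root_.QCD := by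
  have key : ∀ Nf : ℕ, Nf = 2 ∨ Nf = 3 → QCDOf Nf := by
    intro Nf hNf
    obtain ⟨reg, hMS, hCh, hAS, h⟩ := h₄ Nf hNf
    refine h₆ Nf hNf ⟨reg, hMS, hCh, hAS, fun m hm => ?_⟩
    obtain ⟨hi, hin, hiii, hiv⟩ := h m hm
    have hii := h₂ h₁ h₃ Nf reg m hm hin
    exact ⟨⟨hi, hii, hiii, hiv⟩, h₅ Nf hNf reg m hm hMS hCh hAS hi hiii hiv hii⟩
  exact ⟨key 2 (Or.inl rfl), key 3 (Or.inr rfl)⟩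

/-- **Drop-in check, route GaussianLinkFrames**: its deciding theorem with C″ in place of the crux. -/
theorem gaussianLinkFrames_closes_of_AF
    (h₁ : Summit.QuantumFields.QCD.Theses.GaussianLinkFrames.FrameAPrioriBound)
    (h₂ : Summit.QuantumFields.QCD.Theses.GaussianLinkFrames.FrameFMClosure)
    (h₃ : Summit.QuantumFields.QCD.Theses.GaussianLinkFrames.ChiralOneScaleTrajectory)
    (h₄ : PhaseQuenchedFlavourDecayAF)
    (h₅ : Summit.QuantumFields.QCD.Theses.GaussianLinkFrames.ChiralGluonicCompletion) : _root_.QCD := by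
  have key : ∀ Nf : ℕ, Nf = 2 ∨ Nf = 3 → QCDOf Nf := by
    intro Nf hNf
    obtain ⟨reg, hMS, hCh, hAS, h⟩ := h₃ Nf hNf
    refine h₅ Nf hNf ⟨reg, hMS, hCh, hAS, fun m hm => ?_⟩
    obtain ⟨hi, hin, hiii, hiv⟩ := h m hm
    have hii := h₂ h₁ Nf reg m hm hin
    exact ⟨⟨hi, hii, hiii, hiv⟩, h₄ Nf hNf reg m hm hMS hCh hAS hi hiii hiv hii⟩
  exact ⟨key 2 (Or.inl rfl), key 3 (Or.inr rfl)⟩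

/-- **C″ modulo the registered open stub**: the restricted crux from B (hypothesis verbatim = `stub_minorMomentsCore`). -/
theorem phaseQuenchedFlavourDecayAF_of_aprioriMinorMoments
    (hB : ∀ (Nf : ℕ) (reg : QCDRegularisation Nf) (m : Fin Nf → ℝ), (∀ f, 0 < m f) → (∃ s δ C : ℝ, 0 < s ∧ s < 1 ∧ 0 < δ ∧ ∀ᶠ k in atTop, ∀ S : ℕ, reg.L k ≤ S → ∀ (f : Fin Nf) (v : Literature.Probability.LatticeModels.Site 4), v ∈ box 4 S → (∫ U : GaugeConfig 4 (2 * S + 1) (Matrix.specialUnitaryGroup (Fin 3) ℂ), ‖(diracMatrix U fun fl => reg.mcrit k + reg.a k * m fl / reg.Zm k).det‖ * (∑ a : Fin 3, ∑ i : Fin 4, ∑ b : Fin 3, ∑ j : Fin 4, ‖(diracMatrix U fun fl => reg.mcrit k + reg.a k * m fl / reg.Zm k)⁻¹ (quarkEquiv (f, (Torus.proj (2 * S + 1) 0, a, i))) (quarkEquiv (f, (Torus.proj (2 * S + 1) (v), b, j)))‖) ^ s ∂(wilsonMeasure (fundamentalRep (Fin 3)) (reg.β k))) / (∫ U : GaugeConfig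 4 (2 * S + 1) (Matrix.specialUnitaryGroup (Fin 3) ℂ), ‖(diracMatrix U fun fl => reg.mcrit k + reg.a k * m fl / reg.Zm k).det‖ ∂(wilsonMeasure (fundamentalRep (Fin 3)) (reg.β k))) ≤ C * Real.exp (-(δ * (reg.a k * ‖v‖)))) → ∃ ε : ℝ, 0 < ε ∧ ∀ r : ℕ, ∃ C : ℝ, ∀ᶠ k in atTop, ∀ S : ℕ, reg.L k ≤ S → ∀ I J : Fin r → QuarkVar Nf (2 * S + 1), Integrable (fun U : GaugeConfig 4 (2 * S + 1) SU3 => ‖(Matrix.of fun a b : Fin r => (diracMatrix U fun fl => reg.mcrit k + reg.a k * m fl / reg.Zm k)⁻¹ (quarkEquiv (I a)) (quarkEquiv (J b))).det‖ ^ (1 + ε)) (qcdLatticeMeasure (2 * S + 1) (reg.β k) fun fl => reg.mcrit k + reg.a k * m fl / reg.Zm k) ∧ qcdPhaseQuenchedExpect (reg.β k) (2 * S + 1) (fun fl => reg.mcrit k + reg.a k * m fl / reg.Zm k) (fun U : GaugeConfig 4 (2 * S + 1) SU3 => ‖(Matrix.of fun a b : Fin r => (diracMatrix U fun fl => reg.mcrit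 k + reg.a k * m fl / reg.Zm k)⁻¹ (quarkEquiv (I a)) (quarkEquiv (J b))).det‖ ^ (1 + ε)) ≤ C) :
    PhaseQuenchedFlavourDecayAF :=
  stub_restrictedReduction (minorMomentsAF_of_aprioriMinorMoments hB)

end Summit.QuantumFields.QCD.Cruxes.PhaseQuenchedFlavourDecay.CrossingSplitIntegrability

end
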